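import Mathlib
import Literature.Analysis.FluidPDE.VectorCalculus
import Literature.Topology.FourManifolds.InteriorConnected
import Summits.NavierStokesRegularity.NavierStokesRegularity.Theorems.ThreadingFluxErtelTowerStrainShadowOffAxes
import HarnessLib

/-!
# Crux `PoloidalLiouville` (stmt-NavierStokesRegularity-1222, W1), crux idea «radial-jerk-tower» (ns-idea-15 g7):
# THE STRAIN SHADOW, VI — the principal AXES do not separate (connectedness input of the global classification)

Support file (`--supports stmt-NavierStokesRegularity-1222`, helper).  Experiment cell `ns-wall-extremal`, width hand
ns-wall-eng-5 g7 (successor of g6), director KEY-NS #186 / director-ns g18 06:48:57Z («GLOBAL → Liouville»); critic of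
record ns-wall-crit-1 g5 (V21-P2: «globalisation to a general connected `U` … the axis points remain»).  0 kit.

The one topological input the GLOBAL `StrainShadowClassification` needs beyond `strainShadowClassification_offAxes`
(p703530): for pairwise distinct strains and every preconnected open `U ⊆ ℝ³`, the set `U ∩ {τ ≠ 0}` (`τ = Sx × x`; its zero
set is the union of the three principal AXES) is again preconnected — removing three lines separates nothing.

* `isPreconnected_inter_of_forall_nhds` — SUBSET form of the tree's local-to-global point-set lemma
  `Literature.Topology.FourManifolds.isPreconnected_of_forall_nhds` (derived from it in the subtype `U`, not restated): an open
  preconnected `U` all of whose points have arbitrarily small neighbourhoods `V` with `V ∩ G` nonempty and preconnected has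
  `U ∩ G` preconnected.
* The LOCAL picture (`exists_nhds_inter_topField_ne_zero`): around every `x ∈ ℝ³` every small ball `V` has `V ∩ {τ ≠ 0}`
  nonempty and preconnected — off the axes `V ∩ {τ ≠ 0} = V`; at an axis point the set
  `W = {y ∈ V | two coordinates of y − x are non-zero}` lies inside `V ∩ {τ ≠ 0}` and is dense in `V`
  (`dense_forall_apply_ne`), and `W` is preconnected (`isPreconnected_ball_pairOff`) because it is covered by the
  STAR-CONVEX «sign pieces» `T_s = {y ∈ V | two of the numbers s_m (y − x)_m are > 0}`, `s ∈ {±1}³`, star centre `x + ε s`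
  (`starConvex_signPiece`), any one of which is joined to the «bridge» point `x + ε(−1,0,1)` through the «hub»
  `x + εσ(1,1,1)` of its family (`hub_mem_signPiece`, `bridge_mem_signPiece`; `isPreconnected_of_forall`).
* ★ `isPreconnected_inter_topField_ne_zero` — the conclusion.

BOOKING (critic's words, V21-P1/P2/P4): point-set / linear-algebra tools for statements about the LINEAR STRAIN SHADOW — not
⟨1222⟩/⟨27585⟩; helper, W1 movement 0; refutes nothing.  `PoloidalLiouville` (1222) / (27585) OPEN; NS regularity NOT proved.
-/

-- the summit and its single problem share the name (D-0017 nested layout)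
set_option linter.dupNamespace false

noncomputable section

namespace Summit.NavierStokesRegularity.NavierStokesRegularity.Theorems.PoloidalLiouville.ErtelTower

open Set Function Filter Topology Metric
open scoped Topology RealInnerProductSpace InnerProductSpace
open Literature.Analysis.FluidPDE
open Summit.NavierStokesRegularity.NavierStokesRegularity.Theorems.PoloidalLiouville.HorizonTower (E3)

/-! ### 1. Local-to-global preconnectedness, subset form -/

section PointSet

variable {X : Type*} [TopologicalSpace X]

/-- **Local-to-global preconnectedness for an open preconnected SUBSET** (subset form of the tree's
`Literature.Topology.FourManifolds.isPreconnected_of_forall_nhds`, obtained from it in the subtype `U`): if `U` is open and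
preconnected and every point of `U` has arbitrarily small neighbourhoods `V` with `V ∩ G` nonempty and preconnected, then
`U ∩ G` is preconnected. -/
theorem isPreconnected_inter_of_forall_nhds {U G : Set X} (hUo : IsOpen U) (hUc : IsPreconnected U)
    (h : ∀ x ∈ U, ∀ N ∈ 𝓝 x, ∃ V ∈ 𝓝 x, V ⊆ N ∧ (V ∩ G).Nonempty ∧ IsPreconnected (V ∩ G)) :
    IsPreconnected (U ∩ G) := by
  haveI : PreconnectedSpace U := Subtype.preconnectedSpace hUc
  have key : IsPreconnected (((↑) : U → X) ⁻¹' G) := by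
    refine Literature.Topology.FourManifolds.isPreconnected_of_forall_nhds fun x N hN => ?_
    obtain ⟨N', hN', hN'sub⟩ := (mem_nhds_subtype U x N).mp hN
    obtain ⟨V, hV, hVN, hVne, hVc⟩ := h x x.2 (N' ∩ U) (inter_mem hN' (hUo.mem_nhds x.2))
    have hVU : V ⊆ U := fun z hz => (hVN hz).2
    refine ⟨(↑) ⁻¹' V, (mem_nhds_subtype U x _).mpr ⟨V, hV, Subset.rfl⟩, fun y hy => hN'sub (hVN hy).1, ?_, ?_⟩
    · obtain ⟨z, hzV, hzG⟩ := hVne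
      exact ⟨⟨z, hVU hzV⟩, hzV, hzG⟩
    · have himg : ((↑) : U → X) '' (((↑) : U → X) ⁻¹' V ∩ ((↑) : U → X) ⁻¹' G) = V ∩ G := by
        rw [← preimage_inter, Subtype.image_preimage_coe, inter_eq_right]
        exact fun z hz => hVU hz.1
      exact Topology.IsInducing.subtypeVal.isPreconnected_image.mp (by rw [himg]; exact hVc)
  have himg := key.image ((↑) : U → X) continuous_subtype_val.continuousOn
  rwa [Subtype.image_preimage_coe] at himg

end PointSet

/-! ### 2. The principal axes do not separate: local picture around every point of `ℝ³` -/

section Axes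

variable {a b c : ℝ}

/-- For pairwise distinct strains, `τ = Sx × x ≠ 0` as soon as TWO coordinates are non-zero (the zero set of `τ` is the
union of the three principal axes). -/
theorem topField_ne_zero_of_pair (hab : a ≠ b) (hbc : b ≠ c) (hca : c ≠ a) {y : E3} {i j : Fin 3} (hij : i ≠ j)
    (hi : y i ≠ 0) (hj : y j ≠ 0) : topField a b c y ≠ 0 := by
  intro h
  have h0 : topField a b c y 0 = 0 := by rw [h]; rfl
  have h1 : topField a b c y 1 = 0 := by rw [h]; rfl
  have h2 : topField a b c y 2 = 0 := by rw [h]; rfl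
  rw [(topField_apply a b c y).1] at h0
  rw [(topField_apply a b c y).2.1] at h1
  rw [(topField_apply a b c y).2.2] at h2
  have hab' : a - b ≠ 0 := sub_ne_zero.mpr hab
  have hbc' : b - c ≠ 0 := sub_ne_zero.mpr hbc
  have hca' : c - a ≠ 0 := sub_ne_zero.mpr hca
  fin_cases i <;> fin_cases j <;> simp_all

/-- `{τ ≠ 0}` is dense. -/
theorem dense_topField_ne_zero (hbc : b ≠ c) : Dense {y : E3 | topField a b c y ≠ 0} :=
  dense_offPlanes.mono fun _ hy => topField_ne_zero hbc hy

/-- `{τ ≠ 0}` is open. -/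
theorem isOpen_topField_ne_zero : IsOpen {y : E3 | topField a b c y ≠ 0} :=
  isOpen_ne_fun (contDiff_topField a b c (n := 0)).continuous continuous_const

/-- The points all of whose coordinates differ from those of a given point are dense (the complement is the union of
three planes). -/
theorem dense_forall_apply_ne (x : E3) : Dense {y : E3 | ∀ m, y m ≠ x m} := by
  have hplane : ∀ m : Fin 3, interior {y : E3 | y m = x m} = ∅ := by
    intro m
    refine Set.eq_empty_iff_forall_notMem.mpr fun y hy => ?_
    rw [mem_interior_iff_mem_nhds, Metric.mem_nhds_iff] at hy
    obtain ⟨r, hr, hball⟩ := hy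
    have he : ‖EuclideanSpace.single m (1 : ℝ)‖ = 1 := by
      have h := (EuclideanSpace.basisFun (Fin 3) ℝ).orthonormal.1 m
      rwa [EuclideanSpace.basisFun_apply] at h
    have hmem : y + (r / 2) • EuclideanSpace.single m (1 : ℝ) ∈ Metric.ball y r := by
      rw [Metric.mem_ball, dist_eq_norm, add_sub_cancel_left, norm_smul, he, mul_one, Real.norm_eq_abs,
        abs_of_pos (by positivity)]
      linarith
    have h0 : y m = x m := hball (Metric.mem_ball_self hr)
    have h1 : (y + (r / 2) • EuclideanSpace.single m (1 : ℝ)) m = x m := hball hmem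
    have h2 : (y + (r / 2) • EuclideanSpace.single m (1 : ℝ)) m = y m + r / 2 := by simp
    rw [h2, h0] at h1
    linarith
  have hclosed : ∀ m : Fin 3, IsClosed {y : E3 | y m = x m} := fun m =>
    isClosed_eq (EuclideanSpace.proj m).continuous continuous_const
  have hset : {y : E3 | ∀ m, y m ≠ x m}
      = ({y : E3 | y 0 = x 0} ∪ ({y : E3 | y 1 = x 1} ∪ {y : E3 | y 2 = x 2}))ᶜ := by
    ext y
    simp only [mem_setOf_eq, mem_compl_iff, mem_union, not_or, Fin.forall_fin_succ]
    simp
  rw [hset, ← interior_eq_empty_iff_dense_compl, interior_union_isClosed_of_interior_empty (hclosed 0)]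
  · exact hplane 0
  · rw [interior_union_isClosed_of_interior_empty (hclosed 1) (hplane 2)]
    exact hplane 1

/-- A `{±1}`-vector of `ℝ³` has norm `< 2` (its square norm is `3`). -/
theorem norm_toLp_sign_lt {s : Fin 3 → ℝ} (hs : ∀ m, s m = 1 ∨ s m = -1) :
    ‖(WithLp.toLp 2 s : E3)‖ < 2 := by
  have hsq : ∀ m, s m ^ 2 = 1 := fun m => by rcases hs m with h | h <;> simp [h]
  have h3 : ‖(WithLp.toLp 2 s : E3)‖ ^ 2 = 3 := by
    rw [EuclideanSpace.real_norm_sq_eq, Fin.sum_univ_three]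
    simp only [hsq]
    norm_num
  nlinarith [norm_nonneg (WithLp.toLp 2 s : E3)]

/-- **The star-convex pieces.**  For a sign vector `s ∈ {±1}³` and `2ε < r`, the set
`T_s = {y ∈ B(x,r) | two of the numbers s_m (y_m − x_m) are > 0}` is star-convex about `x + ε s`. -/
theorem starConvex_signPiece (x : E3) {r ε : ℝ} (hε : 0 < ε) (hεr : 2 * ε < r) {s : Fin 3 → ℝ}
    (hs : ∀ m, s m = 1 ∨ s m = -1) :
    StarConvex ℝ (x + ε • (WithLp.toLp 2 s : E3))
      {y : E3 | y ∈ ball x r ∧ ∃ j k : Fin 3, j ≠ k ∧ 0 < s j * (y j - x j) ∧ 0 < s k * (y k - x k)} := by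
  have hsq : ∀ m, s m * s m = 1 := fun m => by rcases hs m with h | h <;> simp [h]
  have hhub : x + ε • (WithLp.toLp 2 s : E3) ∈ ball x r := by
    rw [mem_ball_iff_norm, add_sub_cancel_left, norm_smul, Real.norm_eq_abs, abs_of_pos hε]
    have := norm_toLp_sign_lt hs
    nlinarith
  rintro y ⟨hy, j, k, hjk, hj, hk⟩ p q hp hq hpq
  have hcoord : ∀ m, (p • (x + ε • (WithLp.toLp 2 s : E3)) + q • y) m - x m
      = p * ε * s m + q * (y m - x m) := by
    intro m
    simp only [PiLp.add_apply, PiLp.smul_apply, smul_eq_mul]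
    linear_combination (x m) * hpq
  have key : ∀ m, 0 < s m * (y m - x m) → 0 < s m * ((p • (x + ε • (WithLp.toLp 2 s : E3)) + q • y) m - x m) := by
    intro m hm
    rw [hcoord m]
    have : s m * (p * ε * s m + q * (y m - x m)) = p * ε * (s m * s m) + q * (s m * (y m - x m)) := by ring
    rw [this, hsq m, mul_one]
    rcases hp.eq_or_lt with h | h
    · rw [← h, zero_add] at hpq
      rw [← h, hpq]
      simpa using hm
    · nlinarith [mul_nonneg hq hm.le, mul_pos h hε]
  exact ⟨convex_ball x r hhub hy hp hq hpq, j, k, hjk, key j hj, key k hk⟩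

/-- A sign piece lies inside the «two coordinates off» set `W`. -/
theorem signPiece_subset (x : E3) (r : ℝ) (s : Fin 3 → ℝ) :
    {y : E3 | y ∈ ball x r ∧ ∃ j k : Fin 3, j ≠ k ∧ 0 < s j * (y j - x j) ∧ 0 < s k * (y k - x k)}
      ⊆ {y : E3 | y ∈ ball x r ∧ ∃ j k : Fin 3, j ≠ k ∧ y j ≠ x j ∧ y k ≠ x k} := by
  rintro y ⟨hy, j, k, hjk, hj, hk⟩
  refine ⟨hy, j, k, hjk, fun h => ?_, fun h => ?_⟩
  · rw [h, sub_self, mul_zero] at hj; exact lt_irrefl 0 hj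
  · rw [h, sub_self, mul_zero] at hk; exact lt_irrefl 0 hk

/-- The star centre `x + ε s` belongs to its own sign piece `T_s`. -/
theorem centre_mem_signPiece (x : E3) {r ε : ℝ} (hε : 0 < ε) (hεr : 2 * ε < r) {s : Fin 3 → ℝ}
    (hs : ∀ m, s m = 1 ∨ s m = -1) :
    x + ε • (WithLp.toLp 2 s : E3)
      ∈ {y : E3 | y ∈ ball x r ∧ ∃ j k : Fin 3, j ≠ k ∧ 0 < s j * (y j - x j) ∧ 0 < s k * (y k - x k)} := by
  have hsq : ∀ m, s m * s m = 1 := fun m => by rcases hs m with h | h <;> simp [h]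
  have hm : ∀ m, 0 < s m * ((x + ε • (WithLp.toLp 2 s : E3)) m - x m) := by
    intro m
    have : (x + ε • (WithLp.toLp 2 s : E3)) m - x m = ε * s m := by
      simp only [PiLp.add_apply, PiLp.smul_apply, smul_eq_mul]; ring
    rw [this, show s m * (ε * s m) = ε * (s m * s m) by ring, hsq m, mul_one]; exact hε
  refine ⟨?_, 0, 1, by decide, hm 0, hm 1⟩
  rw [mem_ball_iff_norm, add_sub_cancel_left, norm_smul, Real.norm_eq_abs, abs_of_pos hε]
  have := norm_toLp_sign_lt hs
  nlinarith

/-- The «hub» `x + εσ(1,1,1)` belongs to every sign piece `T_s` whose sign vector takes the value `σ` twice. -/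
theorem hub_mem_signPiece (x : E3) {r ε : ℝ} (hε : 0 < ε) (hεr : 2 * ε < r) {s : Fin 3 → ℝ} {σ : ℝ}
    (hσ : σ = 1 ∨ σ = -1) {j k : Fin 3} (hjk : j ≠ k) (hj : s j = σ) (hk : s k = σ) :
    x + ε • (WithLp.toLp 2 (fun _ => σ) : E3)
      ∈ {y : E3 | y ∈ ball x r ∧ ∃ j k : Fin 3, j ≠ k ∧ 0 < s j * (y j - x j) ∧ 0 < s k * (y k - x k)} := by
  have hσσ : σ * σ = 1 := by rcases hσ with h | h <;> simp [h]
  refine ⟨?_, j, k, hjk, ?_, ?_⟩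
  · rw [mem_ball_iff_norm, add_sub_cancel_left, norm_smul, Real.norm_eq_abs, abs_of_pos hε]
    have := norm_toLp_sign_lt (s := fun _ : Fin 3 => σ) fun _ => hσ
    nlinarith
  · have : (x + ε • (WithLp.toLp 2 (fun _ => σ) : E3)) j - x j = ε * σ := by
      simp only [PiLp.add_apply, PiLp.smul_apply, smul_eq_mul]; ring
    rw [this, hj, show σ * (ε * σ) = ε * (σ * σ) by ring, hσσ, mul_one]; exact hε
  · have : (x + ε • (WithLp.toLp 2 (fun _ => σ) : E3)) k - x k = ε * σ := by
      simp only [PiLp.add_apply, PiLp.smul_apply, smul_eq_mul]; ring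
    rw [this, hk, show σ * (ε * σ) = ε * (σ * σ) by ring, hσσ, mul_one]; exact hε

/-- The «bridge» point `x + ε(−1,0,1)` belongs to the sign piece of `(−1, σ, 1)` for either `σ`. -/
theorem bridge_mem_signPiece (x : E3) {r ε : ℝ} (hε : 0 < ε) (hεr : 2 * ε < r) (σ : ℝ) :
    x + ε • (WithLp.toLp 2 ![-1, 0, 1] : E3)
      ∈ {y : E3 | y ∈ ball x r ∧
          ∃ j k : Fin 3, j ≠ k ∧ 0 < ![-1, σ, 1] j * (y j - x j) ∧ 0 < ![-1, σ, 1] k * (y k - x k)} := by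
  refine ⟨?_, 0, 2, by decide, ?_, ?_⟩
  · rw [mem_ball_iff_norm, add_sub_cancel_left, norm_smul, Real.norm_eq_abs, abs_of_pos hε]
    have h2 : ‖(WithLp.toLp 2 ![-1, 0, 1] : E3)‖ ^ 2 = 2 := by
      rw [EuclideanSpace.real_norm_sq_eq, Fin.sum_univ_three]
      simp
      norm_num
    have : ‖(WithLp.toLp 2 ![-1, 0, 1] : E3)‖ < 2 := by
      nlinarith [norm_nonneg (WithLp.toLp 2 ![-1, 0, 1] : E3)]
    nlinarith
  · simp [hε]
  · simp [hε]

/-- Every sign is `1` or `−1`. -/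
private theorem sign_cases (t : ℝ) : (if 0 < t then (1 : ℝ) else -1) = 1 ∨ (if 0 < t then (1 : ℝ) else -1) = -1 := by
  split_ifs <;> simp

/-- `sgn(t) · t > 0` for `t ≠ 0`. -/
private theorem sign_mul_pos {t : ℝ} (ht : t ≠ 0) : 0 < (if 0 < t then (1 : ℝ) else -1) * t := by
  split_ifs with h
  · simpa using h
  · have : t < 0 := lt_of_le_of_ne (not_lt.mp h) ht
    nlinarith

/-- Two distinct indices of `Fin 3` leave a third one. -/
private theorem exists_third {j k : Fin 3} (hjk : j ≠ k) : ∃ i : Fin 3, i ≠ j ∧ i ≠ k := by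
  fin_cases j <;> fin_cases k <;> simp at hjk ⊢ <;> decide

/-- **Ball minus axes, translated: the «two coordinates off» set is preconnected.**  For every centre `x` and radius
`r > 0`, `W = {y ∈ B(x,r) | ∃ j ≠ k, y_j ≠ x_j ∧ y_k ≠ x_k}` (the ball minus the three lines through `x` parallel to the
axes) is preconnected: each point of `W` lies in a star-convex sign piece, which is joined to the bridge point
`x + ε(−1,0,1)` through the hub `x ± ε(1,1,1)` of its family. -/
theorem isPreconnected_ball_pairOff (x : E3) {r : ℝ} (hr : 0 < r) :
    IsPreconnected {y : E3 | y ∈ ball x r ∧ ∃ j k : Fin 3, j ≠ k ∧ y j ≠ x j ∧ y k ≠ x k} := by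
  set ε : ℝ := r / 4 with hεdef
  have hε : 0 < ε := by positivity
  have hεr : 2 * ε < r := by rw [hεdef]; linarith
  apply isPreconnected_of_forall (x + ε • (WithLp.toLp 2 ![-1, 0, 1] : E3))
  rintro y ⟨hy, j, k, hjk, hj, hk⟩
  -- the sign vector of `y`, copied onto the third coordinate
  obtain ⟨i, hij, hik⟩ := exists_third hjk
  set σ : ℝ := if 0 < y j - x j then 1 else -1 with hσdef
  set σk : ℝ := if 0 < y k - x k then 1 else -1 with hσkdef
  have hσ : σ = 1 ∨ σ = -1 := sign_cases _
  have hσk : σk = 1 ∨ σk = -1 := sign_cases _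
  set s : Fin 3 → ℝ := fun m => if m = k then σk else σ with hsdef
  have hs : ∀ m, s m = 1 ∨ s m = -1 := fun m => by
    simp only [hsdef]; split_ifs
    · exact hσk
    · exact hσ
  have hsj : s j = σ := by simp [hsdef, hjk]
  have hsk : s k = σk := by simp [hsdef]
  have hsi : s i = σ := by simp [hsdef, hik]
  -- the bridge sign vector of the same family
  set s' : Fin 3 → ℝ := ![-1, σ, 1] with hs'def
  have hs' : ∀ m, s' m = 1 ∨ s' m = -1 := by
    intro m; fin_cases m
    · simp [hs'def]
    · simpa [hs'def] using hσ
    · simp [hs'def]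
  -- the two pieces
  set T : Set E3 := {z : E3 | z ∈ ball x r ∧ ∃ j k : Fin 3, j ≠ k ∧ 0 < s j * (z j - x j) ∧ 0 < s k * (z k - x k)}
  set T' : Set E3 := {z : E3 | z ∈ ball x r ∧ ∃ j k : Fin 3, j ≠ k ∧ 0 < s' j * (z j - x j) ∧ 0 < s' k * (z k - x k)}
  have hyT : y ∈ T := by
    refine ⟨hy, j, k, hjk, ?_, ?_⟩
    · rw [hsj]; exact sign_mul_pos (sub_ne_zero.mpr hj)
    · rw [hsk]; exact sign_mul_pos (sub_ne_zero.mpr hk)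
  have hwT' : x + ε • (WithLp.toLp 2 ![-1, 0, 1] : E3) ∈ T' := bridge_mem_signPiece x hε hεr σ
  -- the hub of the family `σ` lies in both pieces
  have hhubT : x + ε • (WithLp.toLp 2 (fun _ => σ) : E3) ∈ T :=
    hub_mem_signPiece x hε hεr hσ hij.symm hsj hsi
  have hhubT' : x + ε • (WithLp.toLp 2 (fun _ => σ) : E3) ∈ T' := by
    rcases hσ with h | h
    · exact hub_mem_signPiece x hε hεr (Or.inl h) (j := 1) (k := 2) (by decide) (by simp [hs'def, h])
        (by simp [hs'def, h])
    · exact hub_mem_signPiece x hε hεr (Or.inr h) (j := 0) (k := 1) (by decide) (by simp [hs'def, h])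
        (by simp [hs'def, h])
  refine ⟨T ∪ T', union_subset (signPiece_subset x r s) (signPiece_subset x r s'), mem_union_right _ hwT',
    mem_union_left _ hyT, ?_⟩
  exact IsPreconnected.union _ hhubT hhubT'
    ((starConvex_signPiece x hε hεr hs).isPathConnected
      (centre_mem_signPiece x hε hεr hs)).isConnected.isPreconnected
    ((starConvex_signPiece x hε hεr hs').isPathConnected
      (centre_mem_signPiece x hε hεr hs')).isConnected.isPreconnected

/-- **Local picture: the axes separate no ball.**  For pairwise distinct strains, every point of `ℝ³` has arbitrarily small
neighbourhoods `V` (balls) with `V ∩ {τ ≠ 0}` nonempty and preconnected. -/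
theorem exists_nhds_inter_topField_ne_zero (hab : a ≠ b) (hbc : b ≠ c) (hca : c ≠ a) (x : E3) {N : Set E3}
    (hN : N ∈ 𝓝 x) :
    ∃ V ∈ 𝓝 x, V ⊆ N ∧ (V ∩ {y : E3 | topField a b c y ≠ 0}).Nonempty ∧
      IsPreconnected (V ∩ {y : E3 | topField a b c y ≠ 0}) := by
  obtain ⟨r₀, hr₀, hball⟩ := Metric.mem_nhds_iff.mp hN
  by_cases hxG : topField a b c x ≠ 0
  · -- off the axes: a small ball inside `{τ ≠ 0}`
    obtain ⟨r₁, hr₁, hball₁⟩ := Metric.mem_nhds_iff.mp (isOpen_topField_ne_zero.mem_nhds hxG)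
    refine ⟨ball x (min r₀ r₁), ball_mem_nhds x (lt_min hr₀ hr₁),
      (ball_subset_ball (min_le_left _ _)).trans hball, ⟨x, mem_ball_self (lt_min hr₀ hr₁), hxG⟩, ?_⟩
    have hsub : ball x (min r₀ r₁) ⊆ {y : E3 | topField a b c y ≠ 0} :=
      (ball_subset_ball (min_le_right _ _)).trans hball₁
    rw [inter_eq_left.mpr hsub]
    exact (convex_ball x _).isPreconnected
  · -- on an axis: a ball small enough to meet only the axes through `x`
    push Not at hxG
    have hr : ∃ r, 0 < r ∧ r ≤ r₀ ∧ ∀ y ∈ ball x r,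
        (∃ j k : Fin 3, j ≠ k ∧ y j ≠ x j ∧ y k ≠ x k) → topField a b c y ≠ 0 := by
      by_cases hex : ∃ i, x i ≠ 0
      · obtain ⟨i, hi⟩ := hex
        have hxj : ∀ j, j ≠ i → x j = 0 := fun j hji => by
          by_contra hxj
          exact topField_ne_zero_of_pair hab hbc hca hji hxj hi hxG
        refine ⟨min r₀ |x i|, lt_min hr₀ (abs_pos.mpr hi), min_le_left _ _, ?_⟩
        rintro y hy ⟨j, k, hjk, hj, hk⟩
        have hyi : y i ≠ 0 := by
          intro h0
          have h1 : |(y - x) i| ≤ ‖y - x‖ := by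
            -- a coordinate is bounded by the Euclidean norm
            rw [EuclideanSpace.norm_eq]
            calc |(y - x) i| = Real.sqrt (‖(y - x) i‖ ^ 2) := by
                  rw [Real.norm_eq_abs, Real.sqrt_sq (abs_nonneg _)]
              _ ≤ Real.sqrt (∑ j, ‖(y - x) j‖ ^ 2) :=
                  Real.sqrt_le_sqrt (Finset.single_le_sum (f := fun j => ‖(y - x) j‖ ^ 2)
                    (fun j _ => sq_nonneg _) (Finset.mem_univ i))
          rw [PiLp.sub_apply, h0, zero_sub, abs_neg] at h1
          have h2 : ‖y - x‖ < |x i| := lt_of_lt_of_le (mem_ball_iff_norm.mp hy) (min_le_right _ _)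
          linarith
        rcases eq_or_ne j i with rfl | hji
        · exact topField_ne_zero_of_pair hab hbc hca hjk hyi (by rwa [hxj k hjk.symm] at hk)
        · exact topField_ne_zero_of_pair hab hbc hca hji (by rwa [hxj j hji] at hj) hyi
      · push Not at hex
        refine ⟨r₀, hr₀, le_rfl, ?_⟩
        rintro y - ⟨j, k, hjk, hj, hk⟩
        exact topField_ne_zero_of_pair hab hbc hca hjk (by rwa [hex j] at hj) (by rwa [hex k] at hk)
    obtain ⟨r, hr, hrr₀, hW⟩ := hr
    refine ⟨ball x r, ball_mem_nhds x hr, (ball_subset_ball hrr₀).trans hball, ?_, ?_⟩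
    · obtain ⟨z, hzG, hzball⟩ := (dense_topField_ne_zero (a := a) hbc).exists_mem_open isOpen_ball
        ⟨x, mem_ball_self hr⟩
      exact ⟨z, hzball, hzG⟩
    · refine (isPreconnected_ball_pairOff x hr).subset_closure ?_ ?_
      · rintro y ⟨hy, hpair⟩
        exact ⟨hy, hW y hy hpair⟩
      · rintro y ⟨hy, -⟩
        have h1 : ball x r ⊆ closure (ball x r ∩ {z : E3 | ∀ m, z m ≠ x m}) :=
          (dense_forall_apply_ne x).open_subset_closure_inter isOpen_ball
        refine closure_mono ?_ (h1 hy)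
        rintro z ⟨hz, hzm⟩
        exact ⟨hz, 0, 1, by decide, hzm 0, hzm 1⟩

/-- **`U ∩ {τ ≠ 0}` is preconnected** for every preconnected open `U ⊆ ℝ³` and pairwise distinct strains: the three
principal axes do not separate. -/
theorem isPreconnected_inter_topField_ne_zero (hab : a ≠ b) (hbc : b ≠ c) (hca : c ≠ a) {U : Set E3}
    (hU : IsOpen U) (hUc : IsPreconnected U) :
    IsPreconnected (U ∩ {y : E3 | topField a b c y ≠ 0}) :=
  isPreconnected_inter_of_forall_nhds hU hUc fun x _ _ hN => exists_nhds_inter_topField_ne_zero hab hbc hca x hN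

end Axes

end Summit.NavierStokesRegularity.NavierStokesRegularity.Theorems.PoloidalLiouville.ErtelTower
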